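import Summits.KontsevichZagierPeriods.KontsevichZagierPeriods.Theorems.RootDecompWalshStrataBallAtoms

/-!
# Ball-cube descent 7/7: the cube-cut ball is an instance of `QuadricBakerDescent` (`d = 3`)

Gen 5 of the decomposition node `WalshStrata` (route `RootDecompWalshStrata`, support item
`QuadricBakerDescent` stmt-KontsevichZagierPeriods-27597, its `d = 3` slice): the first two-variable
`√(quadratic)` weight over CUBE-CUT cells decided inside KZ's rules (1)–(3) over `ℚ` —
`sqrtDescent₂_ball : ∀ γ, SqrtDescent₂ K₇ γ` (part 6) for the ball quadric `P = 7/4 − x² − y² − z²`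
(`D = 7 − 4x² − 4y²`; atoms = the disc `x² + y² < 3/4` and the annulus `3/4 < x² + y² < 7/4` cut by
the faces `x = 1`, `y = 1`, plus null/empty/zero-weight atoms), and the corollary
`ballCube_bakerDescent` (part 7): `(d, P, q) = (3, 7/4 − Σxᵢ², q)` is an instance of
`QuadricBakerDescent` for every `q ∈ ℚ`.  Mechanism: the fibrewise vertex chart
`(v, x) ↦ (x, s(x)·v/(1 + v²))`, `s = √(7 − 4x²)`, makes `√D·|det| = (7 − 4x²)(1 − v²)²/(1 + v²)³`
RATIONAL; Newton–Leibniz in `x` over an arbitrary semialgebraic base (the landed band identity); the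
`√(7 − 4x²)`-CANCELLATION on the algebraic edges `x² = β(v)` (circle) and `x² = α(v)` (face `y = 1`)
under the charts `v₁ = 2p/(s + 2)`, `v₂ = 2/(s + 2p)` (`p = √(3/4 − x²)`) reduces both boundary terms to
`E(x²)·√(3/4 − x²)`, `E ∈ ℚ(X)`, hence to rational integrands by the Euler chart of `x² + y² = 3/4`.
This part: `ball74Poly = 7/4 − x² − y² − z²` (total degree ≤ 2), the base `X74 = (0,1)² ∩ {C > 0}`
with the clamped edge `u74 = min(√C, 1)`, the band description of the cell (`mem_ball74_iff`), the
null circle, and **`ballCube_bakerDescent`**: for every `q ∈ ℚ` and every representation `ρ` with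
`ρ.domain = (0,1)³ ∩ {ball74Poly > 0}` and integrand `q`, `[ρ]` is congruent modulo `KZ.relations` to
an element of the Baker sector — `QuadricBakerDescent` (item 27597) at `(3, ball74Poly, q)`, by the
landed `InBaker.of_band` (rule (3) in `z`), `quadricBakerDescent_two` on the disc and `inBaker_R₂`
(`= SqrtDescent₂ K₇ (q/2)` on the annulus atom).  Imports: part 6; 0 sorry.
[KontsevichZagier2001 §1.2; this node, gen 5]
-/

noncomputable section

open Literature.NumberTheory.Transcendental
open MeasureTheory Set
open MvPolynomial (aeval X C)
open Literature.ModelTheory.ExponentialFields (IsSemialgebraic isSemialgebraic_univ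
  isSemialgebraic_setOf_eval_pos isSemialgebraic_setOf_eval_lt isSemialgebraic_setOf_eval_le
  isSemialgebraic_setOf_eval_nonneg isSemialgebraic_setOf_eval_eq_zero continuous_aeval_real
  tarski_seidenberg_real_holds)
open Summit.KontsevichZagierPeriods.RootDecompWalshStrata.WalshSpanProof (isSemialgebraic_cubeSet
  isBounded_cubeSet)
open Summit.KontsevichZagierPeriods.RootDecompWalshStrata.ConeSpecimen (unitIoo isSemialgebraic_unitIoo
  unitIoo_subset_Icc mem_unitIoo)
open Summit.KontsevichZagierPeriods.RootDecompWalshStrata.PointlessOctant (boxTwo isSemialgebraic_boxTwo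
  boxTwo_subset_Icc euler_inj)

namespace Summit.KontsevichZagierPeriods.RootDecompWalshStrata.ConicDescent.BallCube

/-! #### 23.13 Corollary: the cube-cut ball `(0,1)³ ∩ {x² + y² + z² < 7/4}` is an instance of
`QuadricBakerDescent` (`d = 3`, every rational weight) -/

/-- `Fin.init z 0 = z 0` on `Fin 2` (file-local rfl helper). [folklore] -/
@[simp] private theorem init_apply_zero₂ (z : Fin 2 → ℝ) : Fin.init z 0 = z 0 := rfl

/-- `Fin.last 1 = 1` (file-local rfl helper). [folklore] -/
@[simp] private theorem last_one₂ : (Fin.last 1 : Fin 2) = 1 := rfl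

/-- The constant `0` is `ℚ`-semialgebraic on a `ℚ`-semialgebraic set (file-local copy). [BCR1998 §2.2] -/
private theorem isSemialgebraicFunOn_zero {N : ℕ} {X : Set (Fin N → ℝ)} (hX : IsSemialgebraic ℚ X) :
    IsSemialgebraicFunOn ℚ X fun _ => (0 : ℝ) :=
  (isSemialgebraicFunOn_ratCast hX 0).congr fun _ _ => Rat.cast_zero

/-- `P = 7/4 − x² − y² − z²`. -/
def ball74Poly : MvPolynomial (Fin 3) ℚ := MvPolynomial.C (7 / 4) - X 0 ^ 2 - X 1 ^ 2 - X 2 ^ 2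

/-- Lemma `aeval_ball74Poly` of the ball-cube descent (gen 5; see the section docstring). [this node] -/
@[simp] theorem aeval_ball74Poly (x : Fin 3 → ℝ) :
    aeval x ball74Poly = 7 / 4 - x 0 ^ 2 - x 1 ^ 2 - x 2 ^ 2 := by
  simp only [ball74Poly, map_sub, map_pow, MvPolynomial.aeval_C, MvPolynomial.aeval_X, eq_ratCast]
  push_cast; ring

/-- Lemma `totalDegree_ball74Poly_le` of the ball-cube descent (gen 5; see the section docstring). [this node] -/
theorem totalDegree_ball74Poly_le : ball74Poly.totalDegree ≤ 2 := by
  unfold ball74Poly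
  refine (MvPolynomial.totalDegree_sub _ _).trans (max_le ?_ ?_)
  · refine (MvPolynomial.totalDegree_sub _ _).trans (max_le ?_ ?_)
    · refine (MvPolynomial.totalDegree_sub _ _).trans (max_le ?_ ?_)
      · simp
      · exact (MvPolynomial.totalDegree_pow _ _).trans (by simp)
    · exact (MvPolynomial.totalDegree_pow _ _).trans (by simp)
  · exact (MvPolynomial.totalDegree_pow _ _).trans (by simp)

/-- `C = 7/4 − x² − y²` (the base polynomial). -/
def c74Poly : MvPolynomial (Fin 2) ℚ := MvPolynomial.C (7 / 4) - X 0 ^ 2 - X 1 ^ 2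

/-- Lemma `aeval_c74Poly` of the ball-cube descent (gen 5; see the section docstring). [this node] -/
@[simp] theorem aeval_c74Poly (x : Fin 2 → ℝ) : aeval x c74Poly = 7 / 4 - x 0 ^ 2 - x 1 ^ 2 := by
  simp only [c74Poly, map_sub, map_pow, MvPolynomial.aeval_C, MvPolynomial.aeval_X, eq_ratCast]
  push_cast; ring

/-- `C₁ = 3/4 − x² − y²` (the disc polynomial). -/
def c34Poly : MvPolynomial (Fin 2) ℚ := MvPolynomial.C (3 / 4) - X 0 ^ 2 - X 1 ^ 2

/-- Lemma `aeval_c34Poly` of the ball-cube descent (gen 5; see the section docstring). [this node] -/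
@[simp] theorem aeval_c34Poly (x : Fin 2 → ℝ) : aeval x c34Poly = 3 / 4 - x 0 ^ 2 - x 1 ^ 2 := by
  simp only [c34Poly, map_sub, map_pow, MvPolynomial.aeval_C, MvPolynomial.aeval_X, eq_ratCast]
  push_cast; ring

/-- Lemma `totalDegree_c34Poly_le` of the ball-cube descent (gen 5; see the section docstring). [this node] -/
theorem totalDegree_c34Poly_le : c34Poly.totalDegree ≤ 2 := by
  unfold c34Poly
  refine (MvPolynomial.totalDegree_sub _ _).trans (max_le ?_ ?_)
  · refine (MvPolynomial.totalDegree_sub _ _).trans (max_le ?_ ?_)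
    · simp
    · exact (MvPolynomial.totalDegree_pow _ _).trans (by simp)
  · exact (MvPolynomial.totalDegree_pow _ _).trans (by simp)

/-- The base `X = (0,1)² ∩ {C > 0}` of the ball cell as a band in `z`. -/
def X74 : Set (Fin 2 → ℝ) := {x | (∀ j, 0 < x j ∧ x j < 1) ∧ 0 < aeval x c74Poly}

/-- Lemma `isSemialgebraic_X74` of the ball-cube descent (gen 5; see the section docstring). [this node] -/
theorem isSemialgebraic_X74 : IsSemialgebraic ℚ X74 :=
  (isSemialgebraic_cubeSet 2).inter (isSemialgebraic_setOf_eval_pos c74Poly)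

/-- Lemma `X74_subset_Icc` of the ball-cube descent (gen 5; see the section docstring). [this node] -/
theorem X74_subset_Icc : X74 ⊆ Icc 0 1 := fun _ hw => ⟨fun j => (hw.1 j).1.le, fun j => (hw.1 j).2.le⟩

/-- The clamped upper edge `min(√C, 1)` of the fibre in `z`. -/
def u74 (w : Fin 2 → ℝ) : ℝ := clamp (√(7 / 4 - w 0 ^ 2 - w 1 ^ 2))

/-- Lemma `isSemialgebraicFunOn_u74` of the ball-cube descent (gen 5; see the section docstring). [this node] -/
theorem isSemialgebraicFunOn_u74 : IsSemialgebraicFunOn ℚ X74 u74 :=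
  IsSemialgebraicFunOn.clamp isSemialgebraic_X74 (IsSemialgebraicFunOn.sqrt_holds
    ((isSemialgebraicFunOn_aeval isSemialgebraic_X74 c74Poly).congr fun w _ => aeval_c74Poly w))

/-- The ball cell is the open band `0 < z < min(√C, 1)` over `X`. -/
theorem mem_ball74_iff (z : Fin 3 → ℝ) :
    z ∈ {w : Fin 3 → ℝ | (∀ j, 0 < w j ∧ w j < 1) ∧ 0 < aeval w ball74Poly} ↔
      z ∈ oband X74 (fun _ => 0) u74 := by
  simp only [mem_setOf_eq, mem_oband, X74, u74, aeval_ball74Poly, aeval_c74Poly, Fin.init,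
    Fin.castSucc_zero, Fin.castSucc_one]
  constructor
  · rintro ⟨hw, hP⟩
    have hC : z 2 ^ 2 < 7 / 4 - z 0 ^ 2 - z 1 ^ 2 := by linarith
    refine ⟨⟨fun j => hw (Fin.castSucc j), by nlinarith [sq_nonneg (z 2)]⟩, (hw 2).1, ?_⟩
    exact (lt_clamp_iff (hw 2).1 (hw 2).2).2 ((Real.lt_sqrt (hw 2).1.le).2 hC)
  · rintro ⟨⟨hu, hCpos⟩, h0, h1⟩
    have h1' : z 2 < 1 := lt_of_lt_of_le h1 (clamp_le_one _)
    have hs : z 2 < √(7 / 4 - z 0 ^ 2 - z 1 ^ 2) := (lt_clamp_iff h0 h1').1 h1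
    have hsq : z 2 ^ 2 < 7 / 4 - z 0 ^ 2 - z 1 ^ 2 := (Real.lt_sqrt h0.le).1 hs
    refine ⟨fun j => ?_, by linarith⟩
    fin_cases j
    · exact hu 0
    · exact hu 1
    · exact ⟨h0, h1'⟩

/-- The closure of the annulus piece inside the base: `R₂ᶜˡ = (0,1)² ∩ {3/4 ≤ x² + y² < 7/4}`. -/
def R₂c : Set (Fin 2 → ℝ) := {u | (∀ j, 0 < u j ∧ u j < 1) ∧ 3 / 4 ≤ u 0 ^ 2 + u 1 ^ 2 ∧ u 0 ^ 2 + u 1 ^ 2 < 7 / 4}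

/-- The null circle `(0,1)² ∩ {x² + y² = 3/4}`. -/
def A₀ : Set (Fin 2 → ℝ) := {u | (∀ j, 0 < u j ∧ u j < 1) ∧ u 0 ^ 2 + u 1 ^ 2 = 3 / 4}

/-- Lemma `isSemialgebraic_R₂c` of the ball-cube descent (gen 5; see the section docstring). [this node] -/
theorem isSemialgebraic_R₂c : IsSemialgebraic ℚ R₂c := by
  have h := (isSemialgebraic_boxTwo.inter (isSemialgebraic_setOf_eval_nonneg (k := ℚ) (R := ℝ)
    (4 * X 0 ^ 2 + 4 * X 1 ^ 2 - 3 : MvPolynomial (Fin 2) ℚ))).inter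
    (isSemialgebraic_setOf_eval_pos (k := ℚ) (R := ℝ) (7 - 4 * X 0 ^ 2 - 4 * X 1 ^ 2 : MvPolynomial (Fin 2) ℚ))
  convert h using 1
  ext u
  simp only [R₂c, boxTwo, mem_inter_iff, mem_setOf_eq, map_sub, map_add, map_mul, map_pow,
    MvPolynomial.aeval_X, map_ofNat]
  constructor
  · rintro ⟨hb, h1, h2⟩; exact ⟨⟨hb, by linarith⟩, by linarith⟩
  · rintro ⟨⟨hb, h1⟩, h2⟩; exact ⟨hb, by linarith, by linarith⟩

/-- Lemma `isSemialgebraic_A₀` of the ball-cube descent (gen 5; see the section docstring). [this node] -/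
theorem isSemialgebraic_A₀ : IsSemialgebraic ℚ A₀ := by
  have h := isSemialgebraic_boxTwo.inter (isSemialgebraic_setOf_eval_eq_zero (k := ℚ) (R := ℝ)
    (4 * X 0 ^ 2 + 4 * X 1 ^ 2 - 3 : MvPolynomial (Fin 2) ℚ))
  convert h using 1
  ext u
  simp only [A₀, boxTwo, mem_inter_iff, mem_setOf_eq, map_sub, map_add, map_mul, map_pow,
    MvPolynomial.aeval_X, map_ofNat]
  constructor
  · rintro ⟨hb, h1⟩; exact ⟨hb, by linarith⟩
  · rintro ⟨hb, h1⟩; exact ⟨hb, by linarith⟩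

/-- The circle `(0,1)² ∩ {x² + y² = 3/4}` is null (a graph). -/
theorem volume_A₀ : volume A₀ = 0 := by
  have hu : IsSemialgebraicFunOn ℚ unitIoo fun w => √(3 / 4 - w 0 ^ 2) :=
    (IsSemialgebraicFunOn.sqrt_holds (isSemialgebraicFunOn_aeval isSemialgebraic_unitIoo
      (MvPolynomial.C (3 / 4) - X 0 ^ 2))).congr fun w _ => by
        simp only [map_sub, map_pow, MvPolynomial.aeval_C, MvPolynomial.aeval_X, eq_ratCast]
        push_cast; ring_nf
  refine measure_mono_null (fun u hu' => ?_) (KZ.volume_graph_eq_zero hu)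
  obtain ⟨hb, h2⟩ := hu'
  refine ⟨by rw [mem_unitIoo, init_apply_zero₂]; exact hb 0, ?_⟩
  rw [last_one₂, init_apply_zero₂, ← Real.sqrt_sq (hb 1).1.le]
  congr 1
  linarith

/-- `√(7 − 4a − 4b) = 2√(7/4 − a − b)`. -/
theorem sqrt_D_eq (a b : ℝ) : √(7 - 4 * a ^ 2 - 4 * b ^ 2) = 2 * √(7 / 4 - a ^ 2 - b ^ 2) := by
  rw [show (7 : ℝ) - 4 * a ^ 2 - 4 * b ^ 2 = 2 ^ 2 * (7 / 4 - a ^ 2 - b ^ 2) by ring,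
    Real.sqrt_mul (by positivity), Real.sqrt_sq (by norm_num)]

/-- **The cube-cut ball is an instance of `QuadricBakerDescent`** (`d = 3`,
`P = 7/4 − x² − y² − z²`, every `q ∈ ℚ`): the cell `(0,1)³ ∩ {x² + y² + z² < 7/4}` — cut by all
three far faces of the cube, with no adapted symmetry and no rational simplification — lands in the
Baker sector inside the three rules: Newton–Leibniz in `z` (band identity over the base
`(0,1)² ∩ {x² + y² < 7/4}` with the clamped edge `min(√(7/4 − x² − y²), 1)`), the disc piece by
`quadricBakerDescent_two`, the annulus piece by `inBaker_R₂` (= `SqrtDescent₂ K₇ (q/2)` on the atom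
`R₂`). [KontsevichZagier2001 §1.2; this node, gen 5] -/
theorem ballCube_bakerDescent (q : ℚ) (ρ : KZ.IntegralRep 3)
    (hρ : ρ.domain = {x | (∀ j, 0 < x j ∧ x j < 1) ∧ 0 < MvPolynomial.aeval x ball74Poly} ∧
      ∀ x ∈ ρ.domain, ρ.integrand x = (q : ℝ)) :
    ∃ y ∈ AddSubgroup.closure
        {y : KZ.FormalRep | ∃ (m : ℕ) (N : KZ.IntegralRep m), m ≤ 1 ∧ N.IsRational ∧ y = KZ.of N},
      KZ.of ρ - y ∈ KZ.relations := by
  have hdom : ρ.domain = oband X74 (fun _ => 0) u74 := by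
    rw [hρ.1]; ext z; exact mem_ball74_iff z
  suffices h : InBaker (KZ.of (lenRep X74 isSemialgebraic_X74 X74_subset_Icc (fun _ => 0) u74
      (isSemialgebraicFunOn_zero isSemialgebraic_X74) isSemialgebraicFunOn_u74 (fun _ _ => le_rfl)
      (fun _ _ => clamp_nonneg _) (fun _ _ => clamp_le_one _) q)) by
    obtain ⟨y, hy, hrel⟩ := InBaker.of_band ρ X74 isSemialgebraic_X74 X74_subset_Icc (fun _ => 0) u74
      (isSemialgebraicFunOn_zero isSemialgebraic_X74) isSemialgebraicFunOn_u74 (fun _ _ => le_rfl)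
      (fun _ _ => clamp_nonneg _) (fun _ _ => clamp_le_one _) q hdom hρ.2 h
    exact ⟨y, hy, hrel⟩
  set L := lenRep X74 isSemialgebraic_X74 X74_subset_Icc (fun _ => 0) u74
      (isSemialgebraicFunOn_zero isSemialgebraic_X74) isSemialgebraicFunOn_u74 (fun _ _ => le_rfl)
      (fun _ _ => clamp_nonneg _) (fun _ _ => clamp_le_one _) q with hL
  have hLd : L.domain = X74 := rfl
  have hLi : ∀ w, L.integrand w = (q : ℝ) * (u74 w - 0) := fun w => rfl
  -- the base splits as `R₁ ∪ R₂ᶜˡ`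
  have hcov : L.domain = R₁ ∪ R₂c := by
    rw [hLd]
    ext w
    simp only [X74, mem_setOf_eq, aeval_c74Poly, R₁, R₂c, mem_union]
    constructor
    · rintro ⟨hb, hC⟩
      rcases lt_or_ge (w 0 ^ 2 + w 1 ^ 2) (3 / 4) with h | h
      · exact Or.inl ⟨hb, h⟩
      · exact Or.inr ⟨hb, h, by linarith⟩
    · rintro (⟨hb, h⟩ | ⟨hb, h1, h2⟩)
      · exact ⟨hb, by linarith⟩
      · exact ⟨hb, by linarith⟩
  have h1r : R₁ ⊆ L.domain := fun w hw => hcov ▸ Or.inl hw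
  have h2r : R₂c ⊆ L.domain := fun w hw => hcov ▸ Or.inr hw
  refine InBaker.of_split L isSemialgebraic_R₁ isSemialgebraic_R₂c h1r h2r hcov ?_ ?_ ?_
  · have : R₁ ∩ R₂c = ∅ := by
      ext w
      refine ⟨fun hw => ?_, fun h => h.elim⟩
      have ha : w 0 ^ 2 + w 1 ^ 2 < 3 / 4 := hw.1.2
      have hb : 3 / 4 ≤ w 0 ^ 2 + w 1 ^ 2 := hw.2.2.1
      exact False.elim (by linarith)
    rw [this, measure_empty]
  · -- the disc piece: the clamped edge is `1`, the weight is `q`: `quadricBakerDescent_two`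
    obtain ⟨y, hy, hrel⟩ := quadricBakerDescent_two 2 c34Poly q (L.restrict R₁ isSemialgebraic_R₁ h1r)
      ⟨by
        show R₁ = _
        ext u
        simp only [R₁, mem_setOf_eq, aeval_c34Poly]
        constructor
        · rintro ⟨hb, h⟩; exact ⟨hb, by linarith⟩
        · rintro ⟨hb, h⟩; exact ⟨hb, by linarith⟩,
       fun w hw => by
        have hw' : w 0 ^ 2 + w 1 ^ 2 < 3 / 4 := hw.2
        have h1 : 1 ≤ √(7 / 4 - w 0 ^ 2 - w 1 ^ 2) := by
          rw [show (1 : ℝ) = √1 from Real.sqrt_one.symm]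
          exact Real.sqrt_le_sqrt (by linarith)
        rw [KZ.IntegralRep.integrand_restrict, hLi, u74, clamp_of_one_le h1]
        ring⟩
      totalDegree_c34Poly_le le_rfl
    exact ⟨y, hy, hrel⟩
  · -- the closed annulus piece: remove the null circle, then `inBaker_R₂`
    have hcov' : (L.restrict R₂c isSemialgebraic_R₂c h2r).domain = A₀ ∪ R₂ := by
      show R₂c = A₀ ∪ R₂
      ext w
      simp only [R₂c, A₀, R₂, mem_setOf_eq, mem_union]
      constructor
      · rintro ⟨hb, h1, h2⟩
        rcases h1.eq_or_lt with h | h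
        · exact Or.inl ⟨hb, h.symm⟩
        · exact Or.inr ⟨hb, h, h2⟩
      · rintro (⟨hb, h⟩ | ⟨hb, h1, h2⟩)
        · exact ⟨hb, h.ge, by linarith⟩
        · exact ⟨hb, h1.le, h2⟩
    have hAr : A₀ ⊆ (L.restrict R₂c isSemialgebraic_R₂c h2r).domain := fun w hw => hcov' ▸ Or.inl hw
    have hRr : R₂ ⊆ (L.restrict R₂c isSemialgebraic_R₂c h2r).domain := fun w hw => hcov' ▸ Or.inr hw
    refine InBaker.of_split _ isSemialgebraic_A₀ isSemialgebraic_R₂ hAr hRr hcov' ?_ ?_ ?_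
    · have : A₀ ∩ R₂ = ∅ := by
        ext w
        refine ⟨fun hw => ?_, fun h => h.elim⟩
        have ha : w 0 ^ 2 + w 1 ^ 2 = 3 / 4 := hw.1.2
        have hb : 3 / 4 < w 0 ^ 2 + w 1 ^ 2 := hw.2.2.1
        exact False.elim (by linarith)
      rw [this, measure_empty]
    · exact InBaker.of_mem_relations (KZ.of_mem_relations_of_volume_eq_zero _ volume_A₀)
    · refine inBaker_R₂ (q / 2) _ rfl fun w hw => ?_
      have h1 : 3 / 4 < w 0 ^ 2 + w 1 ^ 2 := hw.2.1
      have h2 : w 0 ^ 2 + w 1 ^ 2 < 7 / 4 := hw.2.2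
      have hs0 : 0 ≤ √(7 / 4 - w 0 ^ 2 - w 1 ^ 2) := Real.sqrt_nonneg _
      have hs1 : √(7 / 4 - w 0 ^ 2 - w 1 ^ 2) ≤ 1 := by
        rw [Real.sqrt_le_one]; linarith
      rw [KZ.IntegralRep.integrand_restrict, KZ.IntegralRep.integrand_restrict, hLi, u74,
        clamp_of_mem hs0 hs1, sqrt_D_eq]
      push_cast; ring

end Summit.KontsevichZagierPeriods.RootDecompWalshStrata.ConicDescent.BallCube

end
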